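import Mathlib
import Literature.Computability.QuantumComplexity.GaussianRank
import Literature.Computability.Cryptography.QuantumCircuitProofs
import Literature.Computability.QuantumComplexity.DecisionDiagrams
import Summits.QuantumAdvantage.QuantumAdvantage.Theses.SpinorFlattening

/-!
# Sketch — crux-ideate stmt-QuantumAdvantage-1246 (FlatteningBoundRobust), ideator 1, round 1

First lemmas of the two idea cards (they need not be proved here; they must elaborate).

* Card `isometric-subflattening-deficit`: the one-per-block sub-flattening is `√N ×` an isometry,
  so the FULL Eckart–Young / Bessel deficit count `Σ_S ‖v_S − w_S‖² ≥ N − dim W` converts the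
  rank gap into the SHARP metric bound `C(t,K)·8^K · (1 − ‖M^{⊗t} − φ‖²) ≤ r · D_K(4t)`
  (`FlatteningBoundSharp`, the Transfer C⁺), which implies the crux as typed AND the constant-δ
  kill item NegApproxGaussRankSuperpoly (1245).
* Card `pbw-straightening-deficiency`: the normal-ordering deficiency needs no Witt decomposition
  and no isotropy — ordered-monomial (PBW) straightening in the CAR algebra with the annihilators
  sorted last gives `dim ≤ D_K(2n − m)` for any vector killed by `m` independent `c(v)`'s.
-/

noncomputable section

namespace Summit.QuantumAdvantage.QuantumAdvantage.Cruxes.FlatteningBoundRobust.Sketch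

open Matrix Finset Literature.Computability.QuantumComplexity Literature.Computability.Cryptography
open scoped BigOperators

/-! ### Card A — isometric sub-flattening + full deficit count -/

/-- FIRST LEMMA (card A): Bessel / Eckart–Young deficit count. If `v₁ … v_N` are orthonormal and
`w₁ … w_N` lie in a subspace `W`, then `Σ ‖vᵢ − wᵢ‖² ≥ N − dim W`
(project: `‖vᵢ − wᵢ‖² ≥ 1 − ‖P_W vᵢ‖²`, and `Σᵢ ‖P_W vᵢ‖² ≤ dim W` by Bessel for the
orthonormal family `v` against an orthonormal basis of `W`). Pure Mathlib. -/
theorem deficit_count {E : Type*} [NormedAddCommGroup E] [InnerProductSpace ℂ E]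
    [FiniteDimensional ℂ E] {N : ℕ} (v : Fin N → E) (hv : Orthonormal ℂ v)
    (W : Submodule ℂ E) (w : Fin N → E) (hw : ∀ i, w i ∈ W) :
    (N : ℝ) - (Module.finrank ℂ W : ℝ) ≤ ∑ i, ‖v i - w i‖ ^ 2 := by
  sorry

/-- Column isometry of the sub-flattening: every Majorana word is unitary, so
`‖c_S χ‖² = ‖χ‖²` and hence `Σ_{S ∈ 𝒮} ‖c_S χ‖² = |𝒮| · ‖χ‖²` EXACTLY (not `≤ C(8t,K)‖χ‖²`). -/
theorem normSq_majoranaWord_mulVec (n : ℕ) (L : List (Fin n × Bool)) (χ : QReg n → ℂ) :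
    normSq ((L.map fun p => majorana n p.1 p.2).prod *ᵥ χ) = normSq χ := by
  sorry

/-- TRANSFER C⁺ (card A): the SHARP robust flattening bound, hypothesis-free. For every `r`-term
Gaussian combination `φ` on `4t` qubits and every `K`:
`C(t,K)·8^K · (1 − ‖M^{⊗t} − φ‖²) ≤ r · D_K(4t)`, i.e. `‖M^{⊗t} − φ‖² ≥ 1 − r·D_K(4t)/(C(t,K)8^K)`.
Tight at `t = 1, K = 1, r = 1` (gives `1/2` = the Gaussian infidelity of `|M⟩`). -/
def FlatteningBoundSharp : Prop :=
  ∀ t K r : ℕ, ∀ (a : Fin r → ℂ) (g : Fin r → QReg (t * 4) → ℂ), (∀ i, IsGaussian (g i)) →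
    ((t.choose K * 8 ^ K : ℕ) : ℝ) * (1 - normSq (magicMPow t - ∑ i, a i • g i)) ≤
      ((r * flatteningDeficiency K (t * 4) : ℕ) : ℝ)

/-- C⁺ ⇒ the crux as typed (over the named API, Iff.rfl-identical to the route's inline lets):
from `N(1 − x) ≤ d` and `d < N` in `ℕ` get `N·x ≥ 1`, and `N = C(t,K)8^K ≤ C(8t,K)`
(one-per-block `K`-sets inject into all `K`-subsets of the `8t` Majoranas). -/
theorem robust_of_sharp (h : FlatteningBoundSharp) :
    ∀ t K r : ℕ, r * flatteningDeficiency K (t * 4) < t.choose K * 8 ^ K →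
      ∀ (a : Fin r → ℂ) (g : Fin r → QReg (t * 4) → ℂ), (∀ i, IsGaussian (g i)) →
        (1 : ℝ) ≤ ((t * 8).choose K : ℝ) * normSq (magicMPow t - ∑ i, a i • g i) := by
  sorry

/-- C⁺ ⇒ the KILL item NegApproxGaussRankSuperpoly (stmt-QuantumAdvantage-1245) for EVERY
constant `δ < 1` (named-API form): with `K = ⌊t/4⌋`, `C(t,K)8^K / D_K(4t) ≥ (3/2)^K/(K+1)`
(from `C(t,K) ≥ (t−K)^K/K!`, `D_K(4t) ≤ (K+1)·C(4t,K) ≤ (K+1)(4t)^K/K!`), superpolynomial. -/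
theorem negApprox_of_sharp (h : FlatteningBoundSharp) :
    ∃ δ : ℝ, 0 < δ ∧ δ < 1 ∧ ∀ c : ℕ, ∃ t : ℕ, ∀ r : ℕ, r ≤ t ^ c + c →
      ∀ (a : Fin r → ℂ) (g : Fin r → QReg (t * 4) → ℂ), (∀ i, IsGaussian (g i)) →
        δ ^ 2 < normSq (magicMPow t - ∑ i, a i • g i) := by
  sorry

/-! ### Card B — PBW straightening deficiency (Witt-free, isotropy-free) -/

/-- FIRST LEMMA (card B) = its Transfer C⁺: if `g` is killed by `m` linearly independent
degree-one CAR elements `Σ_p A k p · c_p`, then the words of length `≤ K` and parity `K` in the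
`2n` Majoranas move `g` inside a space of dimension `≤ D_K(2n − m)`: complete the annihilating
vectors to a basis of `ℂ^{2n}` by `2n − m` vectors `u_i`, expand every word in the letters
`c(u_i), c(a_k)`, bubble the `c(a_k)` to the right (each swap costs a scalar times a word shorter
by two, by `majorana_anticommutator`) where they die on `g`, then sort the `c(u_i)`
(`c(u)² = (u·u)·1`): the increasing words of length `≤ K`, parity `K`, in `2n − m` letters span. -/
theorem straightening_deficiency {n m K : ℕ} (g : QReg n → ℂ) (A : Fin m → (Fin n × Bool → ℂ))
    (hA : LinearIndependent ℂ A) (hann : ∀ k, (∑ p, A k p • majorana n p.1 p.2) *ᵥ g = 0) :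
    Module.finrank ℂ (Submodule.span ℂ {v : QReg n → ℂ | ∃ L : List (Fin n × Bool),
      L.length ≤ K ∧ L.length % 2 = K % 2 ∧ v = (L.map fun p => majorana n p.1 p.2).prod *ᵥ g}) ≤
      flatteningDeficiency K (2 * n - m) := by
  sorry

/-- The Gaussian case `m = n` (the deficiency the crux consumes): `dim ≤ D_K(n)`. -/
theorem gaussian_deficiency {n K : ℕ} {g : QReg n → ℂ} (hg : IsGaussian g) :
    Module.finrank ℂ (Submodule.span ℂ {v : QReg n → ℂ | ∃ L : List (Fin n × Bool),
      L.length ≤ K ∧ L.length % 2 = K % 2 ∧ v = (L.map fun p => majorana n p.1 p.2).prod *ᵥ g}) ≤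
      flatteningDeficiency K n := by
  obtain ⟨-, A, hA, hann⟩ := hg
  have h := straightening_deficiency (K := K) g A hA hann
  simpa [two_mul] using h


/-- The labels excited by a block pattern have as many entries as there are excited blocks
(verbatim from the 1245 composition file). -/
theorem length_filterMap_labels' (t : ℕ) (s : Fin t → Option (Fin 4 × Bool)) :
    ((List.finRange t).filterMap fun b =>
        (s b).map fun q => ((finProdFinEquiv (b, q.1) : Fin (t * 4)), q.2)).length =
      (univ.filter fun b => (s b).isSome).card := by
  classical
  have key : ∀ L : List (Fin t), (L.filterMap fun b =>
      (s b).map fun q => ((finProdFinEquiv (b, q.1) : Fin (t * 4)), q.2)).length =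
        (L.filter fun b => (s b).isSome).length := by
    intro L
    induction L with
    | nil => simp
    | cons b L ih =>
      cases hb : s b with
      | none => simp [hb, ih]
      | some q => simp [hb, ih]
  rw [key, ← List.toFinset_card_of_nodup ((List.nodup_finRange t).filter _)]
  congr 1
  ext b
  simp

/-! ### Card A, revised after the 00:48Z boundary — the crux is a COROLLARY of the sibling crux's line

The 1245 line `spectral-mass-flattening` (Cruxes/NegApproxGaussRankSuperpoly/Lines/spectral-mass-flattening.lean)
registers `stub_deficiency`, `stub_flatOrthonormal`, `stub_massBound` (LANDED, sorry-free, in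
`Theorems/SpinorFlatteningNegApproxGaussRankSuperpolyMassBound.lean`) and `stub_countGap`.
`FlatteningBoundRobust` (1246) follows from the first two stub STATEMENTS, the landed `stub_massBound`,
and two counting lemmas (`card_flatFamily`, `choose_mul_pow_le_choose`) — composition below is sorry-free. -/

/-- COUNTING LEMMA 1 (1246-specific glue): the degree-`K` flat family (block patterns exciting exactly
`K` of the `t` blocks, 8 choices per excited block) has `C(t,K)·8^K` members. -/
theorem card_flatFamily (t K : ℕ) :
    Fintype.card {s : Fin t → Option (Fin 4 × Bool) //
      (univ.filter fun b => (s b).isSome).card = K} = t.choose K * 8 ^ K := by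
  sorry

/-- COUNTING LEMMA 2 (1246-specific glue): one-per-block `K`-families inject into all `K`-subsets of
the `8t` Majorana labels: `C(t,K)·8^K ≤ C(8t,K)`. -/
theorem choose_mul_pow_le_choose (t K : ℕ) : t.choose K * 8 ^ K ≤ (t * 8).choose K := by
  sorry

/-- **The corollary**: `FlatteningBoundRobust` BY NAME from the 1245 line's `stub_deficiency` and
`stub_flatOrthonormal` STATEMENTS (hypotheses `hD`, `hO`, copied verbatim from the registered skeleton),
`stub_massBound` (hypothesis `hB`, verbatim; already PROVED in the tree), and the two counting lemmas. Sorry-free composition: with `ι` the degree-`K`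
flat family and `W` the deficiency subspace, `|ι| − dim W ≤ |ι|·normSq(M^t − φ)` (mass bound),
`dim W ≤ r·D_K(4t) < C(t,K)8^K = |ι|` (hypothesis of the crux) ⇒ `1 ≤ |ι|·normSq ≤ C(8t,K)·normSq`. -/
theorem flatteningBoundRobust_of_stubs
    (hD : ∀ (n K r : ℕ) (a : Fin r → ℂ) (g : Fin r → QReg n → ℂ), (∀ i, IsGaussian (g i)) →
      ∃ W : Submodule ℂ (QReg n → ℂ), Module.finrank ℂ W ≤ r * flatteningDeficiency K n ∧
        ∀ l : List (Fin n × Bool), l.length = K →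
          (l.map fun p => majorana n p.1 p.2).prod *ᵥ (∑ i, a i • g i) ∈ W)
    (hO : ∀ (t : ℕ) (mono : (Fin t → Option (Fin 4 × Bool)) → Matrix (QReg (t * 4)) (QReg (t * 4)) ℂ),
      (∀ s, mono s = ((List.finRange t).filterMap fun b =>
          (s b).map fun q => majorana (t * 4) (finProdFinEquiv (b, q.1)) q.2).prod) →
      (∀ s, star (mono s *ᵥ magicMPow t) ⬝ᵥ (mono s *ᵥ magicMPow t) = 1) ∧
        ∀ s s', s ≠ s' → star (mono s *ᵥ magicMPow t) ⬝ᵥ (mono s' *ᵥ magicMPow t) = 0)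
    (hB : ∀ (n : ℕ) (ι : Type) [Fintype ι] (U : ι → Matrix (QReg n) (QReg n) ℂ) (ψ φ : QReg n → ℂ)
      (W : Submodule ℂ (QReg n → ℂ)),
      (∀ i, U i ∈ Matrix.unitaryGroup (QReg n) ℂ) →
      (∀ i, star (U i *ᵥ ψ) ⬝ᵥ (U i *ᵥ ψ) = 1) →
      (∀ i j, i ≠ j → star (U i *ᵥ ψ) ⬝ᵥ (U j *ᵥ ψ) = 0) →
      (∀ i, U i *ᵥ φ ∈ W) →
        (Fintype.card ι : ℝ) - Module.finrank ℂ W ≤ Fintype.card ι * normSq (ψ - φ))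
    (hcard : ∀ t K : ℕ, Fintype.card {s : Fin t → Option (Fin 4 × Bool) //
        (univ.filter fun b => (s b).isSome).card = K} = t.choose K * 8 ^ K)
    (hchoose : ∀ t K : ℕ, t.choose K * 8 ^ K ≤ (t * 8).choose K) :
    Summit.QuantumAdvantage.QuantumAdvantage.Theses.SpinorFlattening.FlatteningBoundRobust := by
  classical
  show ∀ t K r : ℕ, r * flatteningDeficiency K (t * 4) < t.choose K * 8 ^ K →
    ∀ (a : Fin r → ℂ) (g : Fin r → QReg (t * 4) → ℂ), (∀ i, IsGaussian (g i)) →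
      (1 : ℝ) ≤ ((t * 8).choose K : ℝ) * normSq (magicMPow t - ∑ i, a i • g i)
  intro t K r hcount a g hg
  -- the flat family: labels, monomials, index type (verbatim from the 1245 composition)
  let lab : (Fin t → Option (Fin 4 × Bool)) → List (Fin (t * 4) × Bool) := fun s =>
    (List.finRange t).filterMap fun b => (s b).map fun q => (finProdFinEquiv (b, q.1), q.2)
  let mono : (Fin t → Option (Fin 4 × Bool)) → Matrix (QReg (t * 4)) (QReg (t * 4)) ℂ := fun s =>
    ((List.finRange t).filterMap fun b =>
      (s b).map fun q => majorana (t * 4) (finProdFinEquiv (b, q.1)) q.2).prod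
  have hmono_lab : ∀ s, mono s = ((lab s).map fun p => majorana (t * 4) p.1 p.2).prod := by
    intro s
    simp only [mono, lab, List.map_filterMap, Option.map_map]
    rfl
  let ι : Type := {s : Fin t → Option (Fin 4 × Bool) // (univ.filter fun b => (s b).isSome).card = K}
  -- deficiency subspace
  obtain ⟨W, hW, hmem⟩ := hD (t * 4) K r a g hg
  -- unitarity of the monomials
  have hunit : ∀ s, mono s ∈ Matrix.unitaryGroup (QReg (t * 4)) ℂ := by
    intro s
    rw [hmono_lab]
    refine list_prod_mem ?_
    intro x hx
    obtain ⟨p, -, rfl⟩ := List.mem_map.1 hx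
    exact majorana_mem_unitaryGroup _ _ _
  -- orthonormality of the images of M^{⊗t}
  obtain ⟨hO1, hO2⟩ := hO t mono (fun s => rfl)
  -- the mass bound: `hB` is DISCHARGED by the landed `Theorems.SpinorFlattening.stub_massBound`
  -- (SpinorFlatteningNegApproxGaussRankSuperpolyMassBound.lean, sorry-free; module unbuilt on the farm at sketch time)
  have hmass := hB (t * 4) ι (fun s => mono s.1) (magicMPow t) (∑ i, a i • g i) W
    (fun s => hunit s.1) (fun s => hO1 s.1)
    (fun s s' hss' => hO2 s.1 s'.1 fun h => hss' (Subtype.ext h))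
    (fun s => by
      show mono s.1 *ᵥ _ ∈ W
      rw [hmono_lab]
      exact hmem (lab s.1)
        ((Summit.QuantumAdvantage.QuantumAdvantage.Cruxes.FlatteningBoundRobust.Sketch.length_filterMap_labels'
          t s.1).trans s.2))
  -- counting
  have hcardι : Fintype.card ι = t.choose K * 8 ^ K := hcard t K
  have hfin : Module.finrank ℂ W + 1 ≤ Fintype.card ι := by
    rw [hcardι]
    exact lt_of_le_of_lt hW hcount
  have h1 : (1 : ℝ) ≤ (Fintype.card ι : ℝ) - Module.finrank ℂ W := by
    have := (Nat.cast_le (α := ℝ)).2 hfin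
    push_cast at this
    linarith
  have hnn : 0 ≤ normSq (magicMPow t - ∑ i, a i • g i) :=
    Finset.sum_nonneg fun _ _ => by positivity
  have hle : (Fintype.card ι : ℝ) ≤ ((t * 8).choose K : ℝ) := by
    rw [hcardι]
    exact_mod_cast hchoose t K
  calc (1 : ℝ) ≤ (Fintype.card ι : ℝ) - Module.finrank ℂ W := h1
    _ ≤ Fintype.card ι * normSq (magicMPow t - ∑ i, a i • g i) := hmass
    _ ≤ ((t * 8).choose K : ℝ) * normSq (magicMPow t - ∑ i, a i • g i) :=
        mul_le_mul_of_nonneg_right hle hnn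

/-! ### Card C — CSS / stabiliser SUPPORT of the Pauli expectations of `|M⟩^{⊗t}` (lever for `stub_flatOrthonormal`)

`|M⟩^{⊗t}` is the `+1` code state of the `[4,1]` repetition code on every block, so
`⟨M^t| σ_S |M^t⟩ = 0` unless, on EVERY block, the flip letters (`X`/`Y`) of `S` occupy all four wires
or none, and a flip-free block carries an EVEN number of `Z`'s. Products of Majorana words are unit
phases times ONE Pauli string (`pauliString_mul`, DecisionDiagrams.lean), and for two distinct block
patterns `s ≠ s'` the word of `(mono s)† (mono s')` has, on the first differing block, 1–2 flips or
0 flips with exactly one `Z` — inside the vanishing support. A GLOBAL bit-vector computation on the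
closed form of `magicMPow` (no induction on `t`, no `tensorVec` casts). -/

/-- FIRST LEMMA (card C): vanishing support of Pauli expectations of `|M⟩^{⊗t}`. If some block `k`
carries a NON-constant flip pattern of the Pauli word `S`, or carries no flip and an ODD number of `Z`
letters, then `⟨M^{⊗t}| σ_S |M^{⊗t}⟩ = 0` (first case: `σ_S` maps block-constant strings to
non-block-constant ones; second case: the involution complementing block `k` flips the sign). -/
theorem magicMPow_pauli_expect_eq_zero (t : ℕ) (S : Fin (t * 4) → Pauli)
    (h : ∃ k : Fin t,
      (∃ i j : Fin 4, (S (finProdFinEquiv (k, i))).flipsBit ≠ (S (finProdFinEquiv (k, j))).flipsBit) ∨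
      ((∀ i : Fin 4, (S (finProdFinEquiv (k, i))).flipsBit = false) ∧
        Odd ((univ.filter fun i : Fin 4 => S (finProdFinEquiv (k, i)) = Pauli.Z).card))) :
    star (magicMPow t) ⬝ᵥ (pauliString S *ᵥ magicMPow t) = 0 := by
  sorry

/-- Products of Majorana words are unit-phase multiples of ONE Pauli string (fold of
`pauliString_mul`; the letters are the slotwise `letterMul`-products, the phase a product of
`letterPhase`s, each of norm 1). -/
theorem majoranaWord_prod_eq_phase_smul_pauliString (n : ℕ) (L : List (Fin n × Bool)) :
    ∃ (μ : ℂ) (S : Fin n → Pauli), ‖μ‖ = 1 ∧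
      (L.map fun p => majorana n p.1 p.2).prod = μ • pauliString S := by
  sorry

end Summit.QuantumAdvantage.QuantumAdvantage.Cruxes.FlatteningBoundRobust.Sketch
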